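import Summits.QuantumFields.YangMills.Theorems.FluctuationComparisonRegPrIntLS2BetaTorusCellClasses
import Summits.QuantumFields.YangMills.Theorems.FluctuationComparisonRegPrIntLS2BetaComposedKernelDock
import HarnessLib

/-!
# S2β · (S-SRC-1∕2∕3) THE SOURCE DOCK: sources of the composed curl rows are DOCKED LIKE DATA at their own level (no row-sum carry) — the dock for data living on the gen-`j`
# cells (✓`dock_of_kernel` ∘ ✓p831582, `(L^d)^j` normalisation, `n`-free flatness), the finite SCHUR test for nonnegative kernels, and the weighted Cauchy–Schwarz split over source
# levels (geometric weights: the number of levels never becomes a `log N`)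

Cell `ym3-torus` (YM ladder rung R3 = continuum `SU(2)` Yang–Mills on the three-torus at fixed lattice data — a RUNG: NOT d = 4, NOT infinite volume, NOT a mass gap,
NOT Clay).  Width seat `ym3-torus-px13` (gen 27); crux `stmt-QuantumFields-20520`, LINE g18-1 S2β, pairing lane; (SCT″-c)₁ source budget (S-SRC), px13 g27 holder (px16 g23 LANE
PROPOSAL 19:18:32Z).  WHY (HAZARD «SRC-q», px13 g27 19:26:24Z, evidence #58 on 20520): carrying the per-row sources of ✓p831575 by SUP × ROW SUM (`Σ_{j} (L²)^{n−j}·τ n Y j`, (K5) of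
✓`…ComposedDilutionKernel`) is sharp for block-smooth sources and `×L^{3(n−j)}` too much for localized ones; for the QUADRATIC chart remainder `q·M²` this costs `N³` on a single finest bump.
The cure is to propagate sources by the KERNEL and dock each source level like data through ✓`dock_of_kernel` (p831065) + the torus cell classes (p831582) — THIS FILE, lattice-generic.
`--kind proof --supports stmt-QuantumFields-20520 --as helper`, count-neutral, DEFINITION-FREE; generic `P : Params`.

WHAT IS PROVED (sorry-free).
§1 ★`sq_sum_le_inv_weights_mul` — `(Σ_{j∈s} a_j)² ≤ (Σ_j w_j⁻¹)·(Σ_j w_j·a_j²)` for `w_j > 0` (Sedrakyan); the geometric instance `Σ_{j≤n} r^{n−j} ≤ (1−r)⁻¹` is lit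
   ✓`T4BlockTransport.sum_pow_sub_le_inv` (the number of source levels never becomes a `log N`).
§2 ★★`schur_sq_sum_le` — THE FINITE SCHUR TEST: `K ≥ 0`, rows `Σ_z K y z ≤ R`, columns `Σ_y K y z ≤ C` (`R ≥ 0`) ⟹ `Σ_y (Σ_z K y z·f z)² ≤ R·C·Σ_z f z²` (the ℓ²→ℓ² norm of one averaging step is
   `≤ √(L²·L^{2−d}) = √L` at `d = 3`: energies grow by at most `L` per level, not `L⁴`).
§3 ★`sum_comp_blockIter` — `Σ_{q ∈ T^{(0)}} F(blockIter j q) = (L^d)^j·Σ_{c ∈ T^{(j)}} F c` (✓`card_filter_blockIter_eq`).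
§4 ★★★`dock_of_levelData` — THE SOURCE DOCK: for data `s ≥ 0` on `T^{(j)}` (`j ≤ m`), kernels `Kj n : T^{(n)} × T^{(j)} → ℝ` with `0 ≤ Kj ≤ μj n`, support drift ≤ 2 read through finest
   representatives (`Kj n Y (blockIter j q) ≠ 0 → |rel Y (blockIter n q)|_κ ≤ 2`), (M-3)'s read cells `sel n i` (generic `θ`, `ends`, `η`) and weights with the LEVEL-`j` FLATNESS
   `Λ n·(μj n∕(L^d)^j)²·(L^d)^n ≤ Λ★` (at `d = 3`, `μj n = L^{−(n−j)}`, `Λ n = L^{m−1−n}`: `Λ★ = L^{m−1−4j}`, `n`-FREE):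
   `Σ_{n≤m} Λ n·Σ_i (Σ_c Kj n (sel n i) c·s c)² ≤ Λ★·(5^d)²·((2(θ+2)+1)^d·η)·(2(L^d−1)∕(L^d−3))·(L^d)^j·Σ_c s c²` — i.e. `≤ C·L^{m−1−j}·‖s‖₂²` at `d = 3`: the ℓ²-ENERGY of the source at
   its own level times that level's (ST) weight, K-uniformly (✓`dock_of_kernel` with `ρ := s ∘ blockIter j`, `K n y q := Kj n (blockIter n y) (blockIter j q)∕(L^d)^j`, §3 twice).

HONEST.  Finite-sum algebra over landed letters; nothing of Bałaban's asserted; the two-index kernel family (K5′) (px16 g23), the chord-energy inputs (Schur chain ∘ Poincaré∕AxStage, px12∕px21 lineage),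
the purse-closeness binder, (BKG), (ST″), (SCT″-c)₁₂₃, (LIFT-LAD′), (TOP-LAD′), LOC, GAP♯∘ (`stub_uniformFibreGapOrbit`, registry 3732b7df UNTOUCHED, 0∕5), the five REGISTERED stubs, S2β, crux
20520, 19936, 19200, `YM3TorusSU2` — NOT proved; rung R3 = SU(2) YM₃ on T³ — NOT d = 4, NOT infinite volume, NOT a mass gap, NOT Clay; the Yang–Mills mass gap is NOT proved.  Axioms standard.

References: [Balaban1985Averaging] CMP **98** (1985) (19)–(20) p.21, Prop. 1 (51) p.26, Prop. 4 (128)–(135) pp.37–38; [Balaban1987RG1] CMP **109** (1987) (0.1)–(0.4), (0.11) pp.251–253.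
-/

set_option autoImplicit false

open Finset

namespace Summit.QuantumFields.YangMills.Theorems.FluctuationComparisonRegPrIntLS2BetaSourceDock

open Literature.MathematicalPhysics.QuantumFieldTheory.Balaban1983to89
open Literature.MathematicalPhysics.QuantumFieldTheory.Balaban1983to89.B14.Eq22Determines (blockIter blockIter_zero blockIter_succ)
open Literature.MathematicalPhysics.QuantumFieldTheory.Balaban1983to89.B15DeterminingSets (embIter)
open Literature.MathematicalPhysics.QuantumFieldTheory.Balaban1983to89.B15Eq177GaugeInvariance (blockIter_embIter)
open Literature.MathematicalPhysics.QuantumFieldTheory.Balaban1983to89.B10Eq27TorusAxialLog (rel)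
open Summit.QuantumFields.YangMills.Theorems.FluctuationComparisonRegPrIntLS2BetaCombPoincare (card_filter_blockIter_eq)
open Summit.QuantumFields.YangMills.Theorems.FluctuationComparisonRegPrIntLS2BetaTorusCellClasses
open Summit.QuantumFields.YangMills.Theorems.FluctuationComparisonRegPrIntLS2BetaComposedKernelDock (dock_of_kernel)

/-! ## §1 Weighted Cauchy–Schwarz over the source levels -/

section Weights

/-- ★ **SEDRAKYAN WITH WEIGHTS**: `(Σ_j a_j)² ≤ (Σ_j w_j⁻¹)·(Σ_j w_j·a_j²)` for positive weights. [folklore] -/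
theorem sq_sum_le_inv_weights_mul {ι : Type*} (s : Finset ι) (a w : ι → ℝ) (hw : ∀ j ∈ s, 0 < w j) :
    (∑ j ∈ s, a j) ^ 2 ≤ (∑ j ∈ s, (w j)⁻¹) * ∑ j ∈ s, w j * a j ^ 2 := by
  rcases s.eq_empty_or_nonempty with hs | hs
  · simp [hs]
  have hpos : 0 < ∑ j ∈ s, (w j)⁻¹ := sum_pos (fun j hj => inv_pos.mpr (hw j hj)) hs
  have h := sq_sum_div_le_sum_sq_div s a (fun j hj => inv_pos.mpr (hw j hj))
  rw [div_le_iff₀ hpos] at h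
  calc (∑ j ∈ s, a j) ^ 2 ≤ (∑ j ∈ s, a j ^ 2 / (w j)⁻¹) * ∑ j ∈ s, (w j)⁻¹ := h
    _ = (∑ j ∈ s, (w j)⁻¹) * ∑ j ∈ s, w j * a j ^ 2 := by
        rw [mul_comm]
        refine congrArg _ (sum_congr rfl fun j _ => ?_)
        rw [div_inv_eq_mul, mul_comm]

-- Geometric weights never see the number of levels: `Σ_{j ≤ n} r^{n−j} ≤ (1 − r)⁻¹` is lit ✓`T4BlockTransport.sum_pow_sub_le_inv` (not restated here; w8 g22 19:39:20Z).

end Weights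

/-! ## §2 The finite Schur test -/

section Schur

/-- ★★ **THE FINITE SCHUR TEST** for a nonnegative kernel: row sums `≤ R` and column sums `≤ C` give `Σ_y (Σ_z K y z·f z)² ≤ R·C·Σ_z f z²` (Cauchy–Schwarz with the weights `K y z`,
then swap the sums).  For one averaging step of the dilution kernel `R = L²`, `C = L^{2−d}`: energies grow by at most `L^{4−d}` per level. [folklore] -/
theorem schur_sq_sum_le {X Z : Type*} [Fintype X] [Fintype Z] (K : X → Z → ℝ) (f : Z → ℝ) {R C : ℝ} (hR0 : 0 ≤ R)
    (hK : ∀ y z, 0 ≤ K y z) (hR : ∀ y, ∑ z, K y z ≤ R) (hC : ∀ z, ∑ y, K y z ≤ C) :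
    ∑ y, (∑ z, K y z * f z) ^ 2 ≤ R * C * ∑ z, f z ^ 2 := by
  -- Cauchy–Schwarz in each row with weights `K y z`
  have hrow : ∀ y, (∑ z, K y z * f z) ^ 2 ≤ R * ∑ z, K y z * f z ^ 2 := by
    intro y
    have hcs := sum_mul_sq_le_sq_mul_sq (s := (univ : Finset Z)) (fun z => Real.sqrt (K y z)) (fun z => Real.sqrt (K y z) * f z)
    have e1 : ∀ z, Real.sqrt (K y z) * (Real.sqrt (K y z) * f z) = K y z * f z := by
      intro z; rw [← mul_assoc, Real.mul_self_sqrt (hK y z)]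
    have e2 : ∀ z, Real.sqrt (K y z) ^ 2 = K y z := fun z => Real.sq_sqrt (hK y z)
    have e3 : ∀ z, (Real.sqrt (K y z) * f z) ^ 2 = K y z * f z ^ 2 := by
      intro z; rw [mul_pow, Real.sq_sqrt (hK y z)]
    simp only [e1, e2, e3] at hcs
    exact hcs.trans (mul_le_mul_of_nonneg_right (hR y) (sum_nonneg fun z _ => mul_nonneg (hK y z) (sq_nonneg _)))
  calc ∑ y, (∑ z, K y z * f z) ^ 2 ≤ ∑ y, R * ∑ z, K y z * f z ^ 2 := sum_le_sum fun y _ => hrow y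
    _ = R * ∑ z, (∑ y, K y z) * f z ^ 2 := by rw [← mul_sum, sum_comm]; simp_rw [sum_mul]
    _ ≤ R * ∑ z, C * f z ^ 2 := by
        refine mul_le_mul_of_nonneg_left (sum_le_sum fun z _ => mul_le_mul_of_nonneg_right (hC z) (sq_nonneg _)) hR0
    _ = R * C * ∑ z, f z ^ 2 := by rw [← mul_sum, mul_assoc]

end Schur

/-! ## §3 Sums over finest representatives of data living on the gen-`j` cells -/

section LevelSums

variable {P : Params}

/-- ★ **`Σ_{q ∈ T^{(0)}} F(blockIter j q) = (L^d)^j · Σ_{c ∈ T^{(j)}} F c`** (every gen-`j` fibre has `(L^d)^j` finest points, ✓`card_filter_blockIter_eq`). [cite: Balaban1987RG1, (0.3) p.252] -/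
theorem sum_comp_blockIter {j : ℕ} (hj : j ≤ P.m + P.K) (F : Site P j → ℝ) :
    ∑ q : Site P 0, F (blockIter j q) = ((P.L ^ P.d : ℕ) : ℝ) ^ j * ∑ c : Site P j, F c := by
  classical
  rw [← sum_fiberwise_of_maps_to (s := (univ : Finset (Site P 0))) (t := (univ : Finset (Site P j))) (g := fun q => blockIter j q) (fun q _ => mem_univ _)]
  rw [mul_sum]
  refine sum_congr rfl fun c _ => ?_
  have hc : ∀ q ∈ univ.filter (fun q : Site P 0 => blockIter j q = c), F (blockIter j q) = F c := by
    intro q hq; rw [mem_filter] at hq; rw [hq.2]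
  rw [sum_congr rfl hc, sum_const, card_filter_blockIter_eq hj c, nsmul_eq_mul]
  push_cast
  ring

end LevelSums

/-! ## §4 The source dock: data on the gen-`j` cells -/

section Dock

variable {P : Params}

/-- ★★★ **THE SOURCE DOCK** — data `s ≥ 0` living on `T^{(j)}` (`j ≤ m`), propagated to the read cells of every generation `n ≤ m` by nonnegative kernels `Kj n` bounded by `μj n` with
support drift ≤ 2 (read through finest representatives), is docked by ✓`dock_of_kernel` exactly like finest data: with the LEVEL-`j` FLATNESS `Λ n·(μj n∕(L^d)^j)²·(L^d)^n ≤ Λ★`,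
`Σ_{n ≤ m} Λ n·Σ_i (Σ_c Kj n (sel n i) c·s c)² ≤ Λ★·(5^d)²·((2(θ+2)+1)^d·η)·(2(L^d−1)∕(L^d−3))·(L^d)^j·Σ_c s c²` — the ℓ²-energy of the source at its own level, no row sum.
[cite: Balaban1985Averaging, Prop. 4 (128)-(135) pp.37-38; Balaban1987RG1, (0.11) p.253] -/
theorem dock_of_levelData (hb : 4 ≤ P.L ^ P.d) {m : ℕ} (hm : m ≤ P.m + P.K) {j : ℕ} (hj : j ≤ m)
    {ι : Type*} [Fintype ι] (ends : ι → Finset (Site P m)) (θ η : ℕ)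
    (hends : ∀ e : Site P m, (univ.filter (fun i : ι => e ∈ ends i)).card ≤ η)
    (s : Site P j → ℝ) (hs : ∀ c, 0 ≤ s c)
    (Kj : (n : ℕ) → Site P n → Site P j → ℝ) (μj : ℕ → ℝ) (hμ : ∀ n, 0 ≤ μj n)
    (hK0 : ∀ n (Y : Site P n) c, 0 ≤ Kj n Y c) (hKμ : ∀ n (Y : Site P n) c, Kj n Y c ≤ μj n)
    (hK4 : ∀ n (Y : Site P n) (q : Site P 0), Kj n Y (blockIter j q) ≠ 0 → ∀ κ, (rel Y (blockIter n q) κ).natAbs ≤ 2)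
    (Λ : ℕ → ℝ) (Λstar : ℝ) (hΛ : ∀ n, 0 ≤ Λ n)
    (hflat : ∀ n ≤ m, Λ n * (μj n / ((P.L ^ P.d : ℕ) : ℝ) ^ j) ^ 2 * ((P.L ^ P.d : ℕ) : ℝ) ^ n ≤ Λstar)
    (sel : (n : ℕ) → ι → Site P n)
    (hsel : ∀ n, n ≤ m → ∀ i, ∃ z : Site P 0, blockIter m z ∈ ends i ∧ ∀ κ, (rel (blockIter n z) (sel n i) κ).natAbs ≤ θ) :
    ∑ n ∈ Finset.range (m + 1), Λ n * ∑ i, (∑ c, Kj n (sel n i) c * s c) ^ 2 ≤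
      Λstar * ((5 ^ P.d : ℕ) : ℝ) ^ 2 * (((2 * (θ + 2) + 1) ^ P.d * η : ℕ) : ℝ) * (2 * (((P.L ^ P.d : ℕ) : ℝ) - 1) / (((P.L ^ P.d : ℕ) : ℝ) - 3)) *
        (((P.L ^ P.d : ℕ) : ℝ) ^ j * ∑ c, s c ^ 2) := by
  classical
  have hjP : j ≤ P.m + P.K := hj.trans hm
  set b : ℝ := ((P.L ^ P.d : ℕ) : ℝ) with hbdef
  have hb0 : 0 < b := by rw [hbdef]; exact_mod_cast pow_pos P.L_pos P.d
  have hbj : 0 < b ^ j := pow_pos hb0 j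
  -- the engine's kernel on finest representatives (zero above the standing range)
  set Ke : ℕ → Site P 0 → Site P 0 → ℝ := fun n y q => if n ≤ P.m + P.K then Kj n (blockIter n y) (blockIter j q) / b ^ j else 0 with hKe
  have hKe_of_le : ∀ {n : ℕ} (hn : n ≤ P.m + P.K) (y q : Site P 0), Ke n y q = Kj n (blockIter n y) (blockIter j q) / b ^ j := by
    intro n hn y q; simp only [hKe, if_pos hn]
  have hdock := dock_of_kernel (X := Site P 0) (ι := ι) (P.L ^ P.d) hb
    (fun n x => univ.filter (fun x' : Site P 0 => blockIter (min n (P.m + P.K)) x' = blockIter (min n (P.m + P.K)) x))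
    (fun n x => mem_cl_self n x) (fun n x y hy => cl_eq_of_mem n x y hy) (fun n x => cl_subset_succ n x) (fun n x => card_cl_le n x)
    (fun q => s (blockIter j q)) (fun q => hs _) m
    (fun n i => (univ.filter (fun Y : Site P n => ∃ z : Site P 0, blockIter m z ∈ ends i ∧ ∀ κ, (rel (blockIter n z) Y κ).natAbs ≤ θ)).image (embIter n))
    Ke (fun n => μj n / b ^ j)
    (fun n y => (univ.filter (fun c : Site P n => ∀ κ, (rel (blockIter n y) c κ).natAbs ≤ 2)).image (embIter n)) (5 ^ P.d)
    (fun n => div_nonneg (hμ n) hbj.le) (fun n y => card_nb_le n y)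
    (fun n x q => by
      by_cases hn : n ≤ P.m + P.K
      · rw [hKe_of_le hn]; exact div_nonneg (hK0 n _ _) hbj.le
      · simp only [hKe, if_neg hn]; exact le_rfl)
    (fun n x q => by
      by_cases hn : n ≤ P.m + P.K
      · rw [hKe_of_le hn]; exact div_le_div_of_nonneg_right (hKμ n _ _) hbj.le
      · simp only [hKe, if_neg hn]; exact div_nonneg (hμ n) hbj.le)
    (fun n x q hne => by
      by_cases hn : n ≤ P.m + P.K
      · rw [hKe_of_le hn] at hne
        exact exists_mem_nb_of_rel_le_two hn x q (hK4 n _ q (fun h0 => hne (by rw [h0, zero_div])))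
      · exact absurd (by simp only [hKe, if_neg hn]) hne)
    (fun i => (univ.filter (fun c : Site P m => ∃ e ∈ ends i, ∀ κ, (rel e c κ).natAbs ≤ θ + 2)).image (embIter m))
    ((univ : Finset (Site P m)).image (embIter m)) ((2 * (θ + 2) + 1) ^ P.d * η)
    (read_cover' hm ends θ) (fun i => top_subset_R ends θ i) (pairwiseDisjoint_cl_image_embIter hm univ)
    (fun r hr => by
      rw [Finset.mem_image] at hr
      obtain ⟨c₀, -, rfl⟩ := hr
      exact card_filter_mem_top_le hm ends θ η hends c₀)
    Λ Λstar hΛ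
    (fun n hn => by simpa only [hbdef] using hflat n hn)
    (fun n i => embIter n (sel n i))
    (fun n hnm i => by
      obtain ⟨z, hz, hrel⟩ := hsel n hnm i
      exact Finset.mem_image_of_mem _ (by rw [Finset.mem_filter]; exact ⟨Finset.mem_univ _, z, hz, hrel⟩))
  -- read the dock's two sides at level `j`
  have hrepr : ∀ n ∈ Finset.range (m + 1), ∀ i,
      ∑ q, Ke n (embIter n (sel n i)) q * s (blockIter j q) = ∑ c, Kj n (sel n i) c * s c := by
    intro n hn i
    rw [Finset.mem_range] at hn
    have hnP : n ≤ P.m + P.K := (show n ≤ m by omega).trans hm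
    have e : ∀ q : Site P 0, Ke n (embIter n (sel n i)) q * s (blockIter j q) =
        (fun c => Kj n (sel n i) c * s c / b ^ j) (blockIter j q) := by
      intro q; rw [hKe_of_le hnP, blockIter_embIter n hnP]; ring
    rw [Finset.sum_congr rfl fun q _ => e q]
    refine (sum_comp_blockIter hjP (fun c => Kj n (sel n i) c * s c / b ^ j)).trans ?_
    rw [← hbdef, Finset.mul_sum]
    refine Finset.sum_congr rfl fun c _ => ?_
    show b ^ j * (Kj n (sel n i) c * s c / b ^ j) = Kj n (sel n i) c * s c
    field_simp
  have hlhs : ∑ n ∈ Finset.range (m + 1), Λ n * ∑ i, (∑ c, Kj n (sel n i) c * s c) ^ 2 =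
      ∑ n ∈ Finset.range (m + 1), Λ n * ∑ i, (∑ q, Ke n (embIter n (sel n i)) q * s (blockIter j q)) ^ 2 :=
    Finset.sum_congr rfl fun n hn => by
      refine congrArg _ (Finset.sum_congr rfl fun i _ => ?_)
      rw [hrepr n hn i]
  have hrhs : ∑ q : Site P 0, s (blockIter j q) ^ 2 = b ^ j * ∑ c, s c ^ 2 := by
    rw [hbdef]; exact sum_comp_blockIter hjP (fun c => s c ^ 2)
  rw [hlhs]
  refine hdock.trans (le_of_eq ?_)
  rw [hrhs, hbdef]

end Dock

end Summit.QuantumFields.YangMills.Theorems.FluctuationComparisonRegPrIntLS2BetaSourceDock
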